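import Summits.QuantumFields.YangMills.Theorems.LuscherReductionDressedRitzPolyakovLiftStaticsPositivity
import Summits.QuantumFields.YangMills.Theorems.LuscherReductionDressedRitzPolyakovLiftGlue
import Summits.QuantumFields.YangMills.Theorems.FemtoTransferGapStrictPositivity
import HarnessLib

/-!
# Route `LuscherReduction`, item `DressedRitz` (stmt-QuantumFields-20205), line «polyakovlift» — the TIME-DRESSED lift (lead's reshape r3 objects):
# `u_i' = K_β^m u_i`, `m = dressSteps L`, its format as a vacuum-subtracted insertion, physicality, non-vanishing, and the merged core clauses

Support DEFINITIONS + fixed-lattice seams of the `FemtoTransferGap` group (LEAD prover ym-lead-20205-polyakovlift g0; route `LuscherReduction`, femto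
rung R2b1; bears on the crux child `DressedRitz` = stmt-QuantumFields-20205).  WHY (evidence #27 `HAZARD-S-LEAK-UV.md` on the item): the SHARP-TIME
3D-flowed lift `u_i = ins φ (flowLiftAt 0 t g_i)` of the birth line carries a two-hard-gluon component of relative weight `≍ κλ⁴/L` at lattice-scale
energies (tree-level flow imprint `Σ_p Γ̃_p X_p × X_{−p}` of the zero mode, `Γ̃_p = O(1)` for hard `p`), harmless for the first-moment clauses (o2)(o5)(o6)
(`λ⁴/L ≪ λ²/L`) but violating the second-centred-moment clause (o4) at its tolerance `λ³/L²` for `L ≫ 1/λ` (one-loop estimate).  The route item's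
own remedy is TIME-DRESSING by powers of the transfer operator («two-stage-dressed slab family `K^m(…)`»): `u_i' := K_β^m u_i` with `m ≍ L` damps
every state of energy `E` by `e^{−2mE}`, leaves `u_i' ⊥ φ` exact and the `O(λ)` slow admixtures `O(λ)`.  This file supplies the dressed objects and the
seams that keep the target `OpPlat.OperatorPlateauAt`: `u_i' = ins φ O_i'` with the PHYSICAL insertion `O_i' = u_i'/φ` (raw vacua vanish nowhere,
`rawVacuum_ne_zero`), so every `O`-generic helper already landed for the line applies to the dressed family verbatim.

* `dressSteps L := L` (physical Euclidean time `ℓ`: `e^{−2L·E}` kills lattice-scale states super-exponentially, reweights slow levels by `e^{−λΔ}`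
  `= 1 − O(λ)`); `dressedLiftVec β φ g := K_β^[dressSteps L] (liftVec β φ g)`; `dressedLiftFamily`;
* `l2_vac_iterate` (`⟨φ, K^m ψ⟩ = λ₀^m⟨φ,ψ⟩`), `l2_vac_ins` (`⟨φ, ins φ O⟩ = 0`), `l2_vac_dressedLiftVec` (`= 0`);
* `isPhys_dressedLiftVec`, `isPhys_div_rawVacuum`, ★ `ins_div_dressedLiftVec` (`ins φ (u'/φ) = u'`), `dressedLiftFamily_eq_ins`;
* `l2_iterate_self_pos` (`K_β` is injective on physical vectors, `β > 0`: tree `qform_su2Rep_pos`) ⇒ ★ `dressedLiftFamily_o0` ((o0) for the dressed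
  family from infvol-p1's `liftFamily_o0`);
* `coreClauses_of_parts` — (o0)(o2) at `C₁`, (o5)(o6) at `C₂`, (o4) at `C₃` ⇒ the five clauses at `C = max` (monotonicity; any family).

HONEST FRAMING: definitions and fixed-lattice bookkeeping on the conditional femto rung R2b1; the stubs of the line are OPEN renormalisation-group
estimates; nothing here bears on infinite volume, the continuum limit or the Clay mass gap.  References: M. Lüscher, U. Wolff, NPB 339 (1990) 222
[cite: LuscherWolff1990]; M. Lüscher, CMP 54 (1977) 283 [cite: Luscher1977, §3]; M. Lüscher, NPB 219 (1983) 233 [cite: Luscher1983, §3].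
-/

set_option autoImplicit false

noncomputable section

open MeasureTheory Filter Topology Real
open Literature.MathematicalPhysics.QuantumFieldTheory (GaugeConfig Site gaugeTransform)
open scoped BigOperators

namespace Summit.QuantumFields.YangMills.Theorems.FemtoTransferGap.PolyakovLift

open Summit.QuantumFields.YangMills.Theorems.FemtoTransferGap

/-! ## §0 The dressed objects -/

/-- Number of TIME-DRESSING steps: `m(L) = L` transfer steps (physical Euclidean time `ℓ`).  Any `m ≳ λL/C` would do for (o4); `m = L` is the
simplest choice that is super-exponential on lattice-scale energies and `O(λ)`-neutral on the slow levels. [cite: LuscherWolff1990] -/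
def dressSteps (L : ℕ) : ℕ := L

/-- The TIME-DRESSED lifted channel vector `u' = K_β^{m(L)} u`, `u = liftVec β φ g = ins φ (flowLiftAt 0 (L²/√λ) g)`. [cite: LuscherWolff1990] -/
def dressedLiftVec {L : ℕ} [NeZero L] (β : ℝ) (φ : GaugeConfig 3 L SU2 → ℝ) (g : GaugeConfig 3 1 SU2 → ℝ) : GaugeConfig 3 L SU2 → ℝ :=
  (transferApply (L := L) β)^[dressSteps L] (liftVec β φ g)

/-- The dressed lifted family `u_i' = dressedLiftVec β φ g_i`. [cite: LuscherWolff1990] -/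
def dressedLiftFamily {L : ℕ} [NeZero L] {k : ℕ} (β : ℝ) (φ : GaugeConfig 3 L SU2 → ℝ) (g : Fin k → (GaugeConfig 3 1 SU2 → ℝ)) :
    Fin k → (GaugeConfig 3 L SU2 → ℝ) :=
  fun i => dressedLiftVec β φ (g i)

/-- `dressedLiftFamily` unfolded. [folklore] -/
theorem dressedLiftFamily_apply {L : ℕ} [NeZero L] {k : ℕ} (β : ℝ) (φ : GaugeConfig 3 L SU2 → ℝ) (g : Fin k → (GaugeConfig 3 1 SU2 → ℝ))
    (i : Fin k) : dressedLiftFamily β φ g i = (transferApply (L := L) β)^[dressSteps L] (liftVec β φ (g i)) := rfl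

section Seams

variable {L : ℕ} [NeZero L]

/-! ## §1 Orthogonality to the vacuum survives dressing -/

/-- `⟨φ, K_β^m ψ⟩ = λ₀^m ⟨φ, ψ⟩` for a physical top eigenvector `φ` and physical `ψ` (symmetry of `K_β`, induction). [cite: ReedSimonIV1978, Thm XIII.1] -/
theorem l2_vac_iterate (β : ℝ) {φ ψ : GaugeConfig 3 L SU2 → ℝ} (hφ : IsPhys φ) (hψ : IsPhys ψ)
    (heig : transferApply β φ = levelValue su2Rep L β 0 • φ) (m : ℕ) :
    l2 φ ((transferApply (L := L) β)^[m] ψ) = levelValue su2Rep L β 0 ^ m * l2 φ ψ := by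
  induction m with
  | zero => simp
  | succ m ih =>
    rw [Function.iterate_succ_apply', ← l2_transferApply_comm β hφ (isPhys_iterate_transferApply β hψ m), heig, l2_smul_left, ih,
      pow_succ]
    ring

/-- `⟨φ, ins φ O⟩ = 0` for a unit physical `φ` and physical `O` (the insertion is vacuum-subtracted). [folklore] -/
theorem l2_vac_ins {φ O : GaugeConfig 3 L SU2 → ℝ} (hφ : IsPhys φ) (hO : IsPhys O) (hφ1 : l2 φ φ = 1) :
    l2 φ (OpPlat.ins φ O) = 0 := by
  set Φ : physSubmodule L := ⟨φ, hφ⟩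
  set P : physSubmodule L := ⟨O * φ, OpPlat.isPhys_mul hO hφ⟩
  have hins : OpPlat.ins φ O = ((P - l2 φ (O * φ) • Φ : physSubmodule L) : GaugeConfig 3 L SU2 → ℝ) := by rw [OpPlat.ins_eq]; rfl
  have h1 : l2Form L Φ Φ = 1 := by simpa [l2Form_apply] using hφ1
  have hc : l2Form L Φ P = l2 φ (O * φ) := by rw [l2Form_apply]
  have h : l2Form L Φ (P - l2 φ (O * φ) • Φ) = 0 := by
    simp only [map_sub, map_smul, smul_eq_mul, hc, h1, mul_one, sub_self]
  rw [hins]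
  have h' := h
  rw [l2Form_apply] at h'
  exact h'

/-- The dressed lifted vector is orthogonal to the raw vacuum. [folklore] -/
theorem l2_vac_dressedLiftVec (β : ℝ) {φ : GaugeConfig 3 L SU2 → ℝ} (hvac : IsRawVacuum β φ) {g : GaugeConfig 3 1 SU2 → ℝ} (hg : IsPhys g) :
    l2 φ (dressedLiftVec β φ g) = 0 := by
  obtain ⟨hφ, hφ1, heig⟩ := hvac
  unfold dressedLiftVec
  rw [l2_vac_iterate β hφ (isPhys_liftVec β hφ hg) heig, l2_vac_ins hφ (isPhys_flowLiftAt 0 _ hg) hφ1, mul_zero]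

/-! ## §2 Physicality; the dressed vector IS a vacuum-subtracted physical insertion -/

/-- The dressed lifted vector is physical. [folklore] -/
theorem isPhys_dressedLiftVec (β : ℝ) {φ : GaugeConfig 3 L SU2 → ℝ} (hφ : IsPhys φ) {g : GaugeConfig 3 1 SU2 → ℝ} (hg : IsPhys g) :
    IsPhys (dressedLiftVec β φ g) :=
  isPhys_iterate_transferApply β (isPhys_liftVec β hφ hg) _

/-- A physical function divided by a raw vacuum (which vanishes nowhere and is bounded below in absolute value) is physical. [folklore] -/
theorem isPhys_div_rawVacuum (β : ℝ) {φ v : GaugeConfig 3 L SU2 → ℝ} (hvac : IsRawVacuum β φ) (hv : IsPhys v) :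
    IsPhys (fun U => v U / φ U) := by
  obtain ⟨hφ, hφ1, heig⟩ := hvac
  obtain ⟨c, hc, hcle⟩ := exists_pos_le_abs_rawVacuum β hφ hφ1 heig
  obtain ⟨Cv, hCv⟩ := hv.bounded
  refine ⟨hv.measurable.div hφ.measurable, ⟨Cv / c, fun U => ?_⟩, fun h U => ?_, fun d z hz U => ?_⟩
  · rw [abs_div]
    exact div_le_div₀ ((abs_nonneg _).trans (hCv U)) (hCv U) hc (hcle U)
  · show v (gaugeTransform h U) / φ (gaugeTransform h U) = v U / φ U
    rw [hv.gaugeInv h U, hφ.gaugeInv h U]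
  · show v (twist d z U) / φ (twist d z U) = v U / φ U
    rw [hv.zeroFlux d z hz U, hφ.zeroFlux d z hz U]

/-- ★ **FORMAT**: the dressed lifted vector IS the vacuum-subtracted insertion of the physical function `u'/φ`: `ins φ (u'/φ) = u'` (raw vacua vanish
nowhere; `⟨φ,u'⟩ = 0`). [cite: LuscherWolff1990] -/
theorem ins_div_dressedLiftVec (β : ℝ) {φ : GaugeConfig 3 L SU2 → ℝ} (hvac : IsRawVacuum β φ) {g : GaugeConfig 3 1 SU2 → ℝ} (hg : IsPhys g) :
    OpPlat.ins φ (fun U => dressedLiftVec β φ g U / φ U) = dressedLiftVec β φ g := by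
  have hne : ∀ U, φ U ≠ 0 := rawVacuum_ne_zero β hvac.1 hvac.2.1 hvac.2.2
  have h := OpPlat.ins_div hne (dressedLiftVec β φ g)
  rw [l2_vac_dressedLiftVec β hvac hg, zero_smul, sub_zero] at h
  exact h

/-- The dressed family as insertions: `dressedLiftFamily β φ g = fun i => ins φ (u_i'/φ)`. [folklore] -/
theorem dressedLiftFamily_eq_ins (β : ℝ) {φ : GaugeConfig 3 L SU2 → ℝ} (hvac : IsRawVacuum β φ) {k : ℕ}
    {g : Fin k → (GaugeConfig 3 1 SU2 → ℝ)} (hg : ∀ i, IsPhys (g i)) :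
    dressedLiftFamily β φ g = fun i => OpPlat.ins φ (fun U => dressedLiftVec β φ (g i) U / φ U) := by
  funext i; rw [ins_div_dressedLiftVec β hvac (hg i)]; rfl

/-! ## §3 Non-vanishing survives dressing (`K_β` injective on physical vectors) -/

/-- `‖K_β^m u‖² > 0` for physical `u` with `‖u‖² > 0` and `β > 0` (strict positivity of the transfer form + Cauchy–Schwarz, induction). [cite: Luscher1977, §3] -/
theorem l2_iterate_self_pos {β : ℝ} (hβ : 0 < β) {u : GaugeConfig 3 L SU2 → ℝ} (hu : IsPhys u) (hpos : 0 < l2 u u) (m : ℕ) :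
    0 < l2 ((transferApply (L := L) β)^[m] u) ((transferApply (L := L) β)^[m] u) := by
  induction m with
  | zero => simpa using hpos
  | succ m ih =>
    set v := (transferApply (L := L) β)^[m] u with hv
    have hvP : IsPhys v := isPhys_iterate_transferApply β hu m
    have hq : 0 < l2 v (transferApply β v) := by rw [← qform_eq_l2_transferApply]; exact qform_su2Rep_pos hβ hvP ih
    have hcs := sq_l2_le hvP (isPhys_transferApply β hvP)
    rw [Function.iterate_succ_apply', ← hv]
    by_contra hle
    rw [not_lt] at hle
    have h0 : l2 (transferApply β v) (transferApply β v) = 0 := le_antisymm hle (l2_self_nonneg _)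
    rw [h0, mul_zero] at hcs
    have : l2 v (transferApply β v) = 0 := pow_eq_zero_iff two_ne_zero |>.mp (le_antisymm hcs (sq_nonneg _))
    exact hq.ne' this

/-- ★ (o0) for the DRESSED family in the window: every dressed lifted vector has positive norm (infvol-p1's `liftFamily_o0` + `l2_iterate_self_pos`).
[cite: Luscher1977, §3] -/
theorem dressedLiftFamily_o0 {lam β : ℝ} (hlam : 0 < lam) (hW : InFemtoWindow lam β L) {φ : GaugeConfig 3 L SU2 → ℝ}
    (hvac : IsRawVacuum β φ) {k : ℕ} {ω : GaugeConfig 3 1 SU2 → ℝ} {g : Fin k → (GaugeConfig 3 1 SU2 → ℝ)}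
    (hbasis : LiftBasis (liftCoupling β L) k ω g) :
    ∀ i : Fin k, 0 < l2 (dressedLiftFamily β φ g i) (dressedLiftFamily β φ g i) := fun i =>
  l2_iterate_self_pos (zero_lt_one.trans_le hW.1) (isPhys_liftVec β hvac.1 (hbasis.2.2.2.2.1 i)) (liftFamily_o0 hlam hW hvac hbasis i) _

/-! ## §4 Merging the three clause groups into the five core clauses (any family) -/

/-- **(o0)(o2) at `C₁`, (o5)(o6) at `C₂`, (o4) at `C₃` ⇒ the five core clauses (o0),(o2),(o4),(o5),(o6) at any `C ≥ C₁, C₂, C₃`** (monotonicity in the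
constant, using the window's sign facts `λ ≥ 0`, `λ₀ ≥ 0`, `μ_j(B) ≥ 0`, `n_i ≥ 0`, `d_ii ≥ 0`). [folklore] -/
theorem coreClauses_of_parts {k : ℕ} {C₁ C₂ C₃ C : ℝ} {lam β : ℝ} (hlam : 0 < lam) (hW : InFemtoWindow lam β L)
    {u : Fin k → (GaugeConfig 3 L SU2 → ℝ)} (hu : ∀ i, IsPhys (u i)) (h1 : C₁ ≤ C) (h2 : C₂ ≤ C) (h3 : C₃ ≤ C)
    (hS : StaticClauses k C₁ β u) (hD : DynamicCoreClauses k C₂ β u) (hK : LeakageClause k C₃ β u) :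
    (∀ i : Fin k, 0 < l2 (u i) (u i)) ∧
    (∀ i l : Fin k, i ≠ l →
      |l2 (u i) (u l)| ≤ C * luscherLambda β L * (Real.sqrt (l2 (u i) (u i)) * Real.sqrt (l2 (u l) (u l)))) ∧
    (∀ i : Fin k,
      l2 (transferApply β (u i)) (transferApply β (u i)) * l2 (u i) (u i) - l2 (u i) (transferApply β (u i)) ^ 2
        ≤ C * (luscherLambda β L ^ 3 / (L : ℝ) ^ 2) * levelValue su2Rep L β 0 ^ 2 * l2 (u i) (u i) ^ 2) ∧
    (∀ i : Fin k,
      l2 (u i) (transferApply β (u i)) * levelValue su2Rep 1 (oneSiteCoupling β L) 0 ≤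
          Real.exp (C * luscherLambda β L ^ 2 / L) *
            (levelValue su2Rep 1 (oneSiteCoupling β L) ((i : ℕ) + 1) * levelValue su2Rep L β 0) * l2 (u i) (u i) ∧
      levelValue su2Rep 1 (oneSiteCoupling β L) ((i : ℕ) + 1) * levelValue su2Rep L β 0 * l2 (u i) (u i) ≤
          Real.exp (C * luscherLambda β L ^ 2 / L) *
            (l2 (u i) (transferApply β (u i)) * levelValue su2Rep 1 (oneSiteCoupling β L) 0)) ∧
    (∀ i l : Fin k, i ≠ l →
      |l2 (u i) (transferApply β (u l)) -
          (l2 (u i) (transferApply β (u i)) / l2 (u i) (u i) + l2 (u l) (transferApply β (u l)) / l2 (u l) (u l)) / 2 *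
            l2 (u i) (u l)|
        ≤ C * (luscherLambda β L ^ 2 / L) * levelValue su2Rep L β 0 *
            (Real.sqrt (l2 (u i) (u i)) * Real.sqrt (l2 (u l) (u l)))) := by
  obtain ⟨h0, ho2⟩ := hS
  obtain ⟨ho5, ho6⟩ := hD
  have hβ0 : 0 ≤ β := zero_le_one.trans hW.1
  have hΛpos : 0 < luscherLambda β L := luscherLambda_pos_of_window hlam hW
  have hΛ : 0 ≤ luscherLambda β L := hΛpos.le
  have hLpos : (0 : ℝ) < L := Nat.cast_pos.mpr (NeZero.pos L)
  have htop0 : 0 ≤ levelValue su2Rep L β 0 := (levelValue_pos_of_window hW 0).le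
  have hBpos : 0 < oneSiteCoupling β L := by
    unfold oneSiteCoupling
    exact div_pos (mul_pos two_pos (pow_pos hLpos 3)) (pow_pos hΛpos 3)
  have hμ : ∀ j : ℕ, 0 ≤ levelValue su2Rep 1 (oneSiteCoupling β L) j := fun j => levelValue_su2Rep_nonneg 1 hBpos.le j
  have hn : ∀ i : Fin k, 0 ≤ l2 (u i) (u i) := fun i => l2_self_nonneg _
  have hd : ∀ i : Fin k, 0 ≤ l2 (u i) (transferApply β (u i)) := fun i => by
    rw [← qform_eq_l2_transferApply]; exact qform_su2Rep_self_nonneg hβ0 (hu i)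
  have hsq : ∀ i l : Fin k, 0 ≤ Real.sqrt (l2 (u i) (u i)) * Real.sqrt (l2 (u l) (u l)) :=
    fun i l => mul_nonneg (Real.sqrt_nonneg _) (Real.sqrt_nonneg _)
  have key : ∀ {a b x : ℝ}, a ≤ b → 0 ≤ x → a * x ≤ b * x := fun h hx => mul_le_mul_of_nonneg_right h hx
  have hexp : Real.exp (C₂ * luscherLambda β L ^ 2 / L) ≤ Real.exp (C * luscherLambda β L ^ 2 / L) :=
    Real.exp_le_exp.mpr (div_le_div_of_nonneg_right (key h2 (sq_nonneg _)) hLpos.le)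
  refine ⟨h0, ?_, ?_, ?_, ?_⟩
  · intro i l hil
    exact (ho2 i l hil).trans (key (key h1 hΛ) (hsq i l))
  · intro i
    exact (hK i).trans (key (key (key h3 (div_nonneg (pow_nonneg hΛ 3) (sq_nonneg _))) (sq_nonneg _)) (sq_nonneg _))
  · intro i
    refine ⟨(ho5 i).1.trans (key (key hexp (mul_nonneg (hμ _) htop0)) (hn i)), (ho5 i).2.trans (key hexp (mul_nonneg (hd i) (hμ 0)))⟩
  · intro i l hil
    exact (ho6 i l hil).trans (key (key (key h2 (div_nonneg (sq_nonneg _) hLpos.le)) htop0) (hsq i l))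

end Seams

end Summit.QuantumFields.YangMills.Theorems.FemtoTransferGap.PolyakovLift

end
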